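import Literature.NumberTheory.Automorphic.Liu2021.NablaGaloisDescent
import Literature.NumberTheory.Automorphic.Liu2021.AppendixC.AlbaneseFunctorial
import Literature.AlgebraicGeometry.Motives.AbelianVarietyBaseChange
import HarnessLib

/-!
# Albanese maps act PIECEWISE BY NORM MAPS on an `α`-compatible fan (Liu 2021, §2.1 proof of the Proposition / Def. 2.3)

[Liu2021] = Yifeng Liu, *Fourier–Jacobi cycles and arithmetic relative trace formula*, Camb. J. Math. **9** (2021); `l. NNNN` =
lines of `FJcycle.tex`.  Topic `NumberTheory/Automorphic/Liu2021`; namespace `Literature.NumberTheory.Automorphic.Liu2021.AppendixC.Albanese`.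
PROOF FILE (theorems only; no definition, no named fact, no instance, no `sorry`).

Over a splitting field `L / k` the Albanese variety of a smooth projective `X` is the product of the Jacobians of the pieces
`X_L = ⊔_c E_c` ([Liu2021] §2.1, proof of the Proposition, l. 1194–1200: «`Alb_{X'} = ∏ᵢ Alb_{Xᵢ}`»), and the tree proves this for
ANY Albanese datum `a : Albanese X` together with the `α`-COMPATIBILITY of the presentation (★
`Albanese.exists_isGalois_isLimit_fan_baseChange_compat`: morphisms `l_c : E_c × E_c → (∇X)_L` over `e_c × e_c` along which `(α_X)_L`
is `diff_c ≫ ι_c`).  This file adds the compatibility with the Albanese MORPHISMS (Def. 2.3, l. 1206–1208: «the induced morphism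
`Alb_u : Alb_Y → Alb_X` by the universal property, which satisfies `Alb_u ∘ α_Y = α_X ∘ ∇u`») that such a presentation forces:

* **`Albanese.inj_comp_map_baseChange_eq_pushforward_comp_inj`** — for `f : X ⟶ X'` over `k`, `α`-compatible piece data for `a` and
  `a'` over `L`, and PIECE MAPS `t_c : E_c ⟶ E'_{φ c}` over `f_L` (`t_c ≫ e'_{φ c} = e_c ≫ f_L`, the output shape of ★
  `Morphisms/CofanPieceMap`): `ι_c ≫ (Alb_f)_L = Nm_{t_c} ≫ ι'_{φ c}` — on the piece `E_c` the base change of the Albanese map IS the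
  norm map (★ `Motives.Jacobian.pushforward`, [Lange2023AbelianVarietiesComplex] §4.5.2) of the piece map followed by the inclusion of the
  target piece's Jacobian.  Proof: homomorphisms out of `J(E_c)` are determined after `diff_c` (★ `Jacobian.hom_ext`); by the
  `α`-compatibilities and `Alb_f ∘ α = α' ∘ ∇f` (★ `Albanese.α_map`) both sides become `l_c ≫ (∇f)_L ≫ (α')_L` resp.
  `(t_c × t_c) ≫ l'_{φ c} ≫ (α')_L`, and `l_c ≫ (∇f)_L = (t_c × t_c) ≫ l'_{φ c}` because both lift `(e_c × e_c) ≫ (f × f)_L` through the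
  MONOMORPHISM `(∇X' ↪ X' × X')_L` (★ `Nabla.map_incl`, ★ `GaloisDescent.isOpenImmersion_bcFunctor_map_left`);
* `Albanese.inj_comp_map_baseChange_lhs_eq` — the same without naming the target Jacobian structure (`… = (t_c × t_c) ≫ l'_{φ c} ≫ (α')_L`);
* **`Albanese.map_baseChange_eq_sum_proj_pushforward_inj`** — with projections `π_c` and `Σ_c π_c ≫ ι_c = 𝟙` (the biproduct
  presentation of ★ `…_fan_baseChange_compat`): `(Alb_f)_L = Σ_c π_c ≫ Nm_{t_c} ≫ ι'_{φ c}` («Hecke translates act on the product of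
  the Jacobians of the pieces by the matrix of norm maps of the piece maps», [Liu2021] §4.2 l. 2074).

No colimit, no rational point, no Galois group is used: only the two compatibility laws and `t_c ≫ e' = e_c ≫ f_L`.  Cell
`hodgecm-mathlib` (D-0151), crux `HLiu418` = stmt-HodgeConjecture-24832, d6 line road (P), `stub_RosH` glue leg (N1) (A-plan2 (g12)
2026-08-30): the complex push–pull words on `⊞_c J(E_c ⊗ ℂ)` intertwine the Hecke endomorphisms of `A_K` along the comparison isogeny.
COUNT-NEUTRAL capital: HC_CM is proved only modulo the 7 printed citations until rung 0 closes; this file discharges none of them.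

## References
* [Liu2021] Y. Liu, arXiv:2102.11518 = Camb. J. Math. 9 (2021): §2.1 Def. 2.1 (1) (l. 1171–1177), Proposition with proof
  (l. 1190–1200), Def. 2.3 (l. 1202–1208); §4.2 (l. 2070–2074).
* [Lange2023AbelianVarietiesComplex] H. Lange, *Abelian Varieties over the Complex Numbers* (2023), §4.5.2 (the norm map `N_f`).
* [Milne1986JacobianVarieties] J. S. Milne, *Jacobian Varieties* (1986), §6 Prop. 6.4, Remark 6.5.
* [GortzWedhorn2020] U. Görtz, T. Wedhorn, *Algebraic Geometry I*, 2nd ed. (2020), Prop. 4.32 (immersions are stable under base change).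
-/

set_option autoImplicit false

noncomputable section

open CategoryTheory CategoryTheory.Limits AlgebraicGeometry MonoidalCategory CartesianMonoidalCategory
open Literature.AlgebraicGeometry.Motives

universe u v w

namespace Literature.NumberTheory.Automorphic.Liu2021.AppendixC

open AbelianVariety (bcSpec bcFunctor)

-- `(A.baseChange L).X` is `(bcFunctor k L).obj A.X` only up to unfolding `AbelianVariety.baseChange` (as in the ★ fan files)
set_option backward.isDefEq.respectTransparency false

namespace Albanese

variable {k : Type u} [Field k] (L : Type u) [Field L] [Algebra k L]
variable {X X' : SchemeOver k} (a : Albanese X) (a' : Albanese X') (f : X ⟶ X')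
-- `α`-compatible piece data for `a` over `L` (the output of ★ `Albanese.exists_isGalois_isLimit_fan_baseChange_compat`, any `L`)
variable {C : Type v} (E : C → SchemeOver L) (e : ∀ c, E c ⟶ (bcFunctor k L).obj X) (𝒥 : ∀ c, Jacobian (E c))
  (ι : ∀ c, (𝒥 c).J ⟶ a.Alb.baseChange L) (l : ∀ c, E c ⊗ E c ⟶ (bcFunctor k L).obj a.nabla.N)
-- the same for `a'`
variable {C' : Type w} (E' : C' → SchemeOver L) (e' : ∀ c', E' c' ⟶ (bcFunctor k L).obj X') (𝒥' : ∀ c', Jacobian (E' c'))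
  (ι' : ∀ c', (𝒥' c').J ⟶ a'.Alb.baseChange L) (l' : ∀ c', E' c' ⊗ E' c' ⟶ (bcFunctor k L).obj a'.nabla.N)
-- piece maps of `f_L` (the output of ★ `Morphisms/CofanPieceMap`)
variable (φ : C → C') (t : ∀ c, E c ⟶ E' (φ c))

/-- **The restriction of `(∇f)_L` to a piece**: if `l_c : E_c × E_c → (∇X)_L` lies over `e_c × e_c` and `l'_{c'}` over `e'_{c'} × e'_{c'}`
(the `incl`-compatibilities of the `α`-compatible fans), and `t_c : E_c → E'_{φ c}` is a piece map of `f_L` (`t_c ≫ e'_{φ c} = e_c ≫ f_L`),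
then `l_c ≫ (∇f)_L = (t_c × t_c) ≫ l'_{φ c}` — both composites lift `(e_c × e_c) ≫ μ ≫ (f × f)_L` through the MONOMORPHISM `(∇X' ↪ X' × X')_L`
(★ `Nabla.map_incl`: `∇f ≫ incl' = incl ≫ (f × f)`; naturality of the monoidal structure `μ` of `(−)_L`; an open immersion stays one after
base change, ★ `GaloisDescent.isOpenImmersion_bcFunctor_map_left`). [cite: Liu2021, Def. 2.1 (1) (FJcycle.tex l. 1174–1176) and §2.1 proof of the Proposition (l. 1194–1200)]
[cite: GortzWedhorn2020, Prop. 4.32] -/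
theorem piece_comp_nablaMap_baseChange_eq
    (hl : ∀ c, l c ≫ (bcFunctor k L).map a.nabla.incl = (e c ⊗ₘ e c) ≫ Functor.LaxMonoidal.μ (bcFunctor k L) X X)
    (hl' : ∀ c', l' c' ≫ (bcFunctor k L).map a'.nabla.incl = (e' c' ⊗ₘ e' c') ≫ Functor.LaxMonoidal.μ (bcFunctor k L) X' X')
    (ht : ∀ c, t c ≫ e' (φ c) = e c ≫ (bcFunctor k L).map f) (c : C) :
    l c ≫ (bcFunctor k L).map (a.nabla.map a'.nabla f) = (t c ⊗ₘ t c) ≫ l' (φ c) := by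
  haveI : Mono ((bcFunctor k L).map a'.nabla.incl) := by
    haveI : IsOpenImmersion a'.nabla.incl.left := a'.nabla.isOpenImmersion_incl
    haveI : IsOpenImmersion ((bcFunctor k L).map a'.nabla.incl).left :=
      GaloisDescent.isOpenImmersion_bcFunctor_map_left L a'.nabla.incl
    exact Over.mono_of_mono_left _
  rw [← cancel_mono ((bcFunctor k L).map a'.nabla.incl), Category.assoc, ← Functor.map_comp, Nabla.map_incl, Functor.map_comp,
    ← Category.assoc, hl c, Category.assoc, ← Functor.LaxMonoidal.μ_natural, ← Category.assoc, tensorHom_comp_tensorHom, ← ht c,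
    ← tensorHom_comp_tensorHom, Category.assoc, ← hl' (φ c), Category.assoc]

/-- **On a piece, `(Alb_f)_L` after `diff_c ≫ ι_c` is `(t_c × t_c) ≫ l'_{φ c} ≫ (α')_L`** (the Albanese-morphism compatibility
`l_c ≫ (α_X)_L = diff_c ≫ ι_c` of the fan, the printed identity `α_X ≫ Alb_f = ∇f ≫ α_{X'}` ★ `Albanese.α_map` base-changed, and
`piece_comp_nablaMap_baseChange_eq`). [cite: Liu2021, Def. 2.3 (FJcycle.tex l. 1206–1208) and §2.1 proof of the Proposition (l. 1194–1200)] -/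
theorem diff_comp_inj_comp_map_baseChange_eq
    (hl : ∀ c, l c ≫ (bcFunctor k L).map a.nabla.incl = (e c ⊗ₘ e c) ≫ Functor.LaxMonoidal.μ (bcFunctor k L) X X)
    (hlα : ∀ c, l c ≫ (bcFunctor k L).map a.α = (𝒥 c).diff ≫ (ι c).hom.hom.hom)
    (hl' : ∀ c', l' c' ≫ (bcFunctor k L).map a'.nabla.incl = (e' c' ⊗ₘ e' c') ≫ Functor.LaxMonoidal.μ (bcFunctor k L) X' X')
    (ht : ∀ c, t c ≫ e' (φ c) = e c ≫ (bcFunctor k L).map f) (c : C) :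
    (𝒥 c).diff ≫ (ι c).hom.hom.hom ≫ (AbelianVariety.Hom.baseChange L (a.map a' f)).hom.hom.hom =
      (t c ⊗ₘ t c) ≫ l' (φ c) ≫ (bcFunctor k L).map a'.α := by
  rw [← Category.assoc, ← hlα c, Category.assoc, AbelianVariety.Hom.baseChange_hom_hom_hom, ← Functor.map_comp, a.α_map a' f,
    Functor.map_comp, ← Category.assoc, a.piece_comp_nablaMap_baseChange_eq L a' f E e l E' e' l' φ t hl hl' ht c, Category.assoc]

/-- **ALBANESE MAPS ACT PIECEWISE BY NORM MAPS.**  For `f : X ⟶ X'` over `k`, `α`-compatible piece data `(E, e, 𝒥, ι, l)` for `a`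
and `(E', e', 𝒥', ι', l')` for `a'` over `L` (the two compatibility laws of ★ `Albanese.exists_isGalois_isLimit_fan_baseChange_compat`,
taken as hypotheses — any such data, any `L`), and piece maps `t_c : E_c ⟶ E'_{φ c}` of `f_L` (`t_c ≫ e'_{φ c} = e_c ≫ f_L`):
**`ι_c ≫ (Alb_f)_L = Nm_{t_c} ≫ ι'_{φ c}`** — the base change of Liu's Albanese map `Alb_f` (Def. 2.3), restricted to the Jacobian of
the piece `E_c`, is the norm map of the piece map ([Lange2023AbelianVarietiesComplex] §4.5.2; ★ `Jacobian.pushforward`) followed by the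
inclusion of `J(E'_{φ c})`.  Proof: both are homomorphisms out of `J(E_c)` with the same composite with `diff_c`
(`diff_comp_inj_comp_map_baseChange_eq`, the `α'`-compatibility and ★ `Jacobian.diff_comp_pushforward`); ★ `Jacobian.hom_ext`.
[cite: Liu2021, Def. 2.3 (FJcycle.tex l. 1206–1208), §2.1 proof of the Proposition (l. 1194–1200) and §4.2 (l. 2074)]
[cite: Lange2023AbelianVarietiesComplex, §4.5.2 (the norm map N_f)] [cite: Milne1986JacobianVarieties, §6 Prop. 6.4 and Remark 6.5] -/
theorem inj_comp_map_baseChange_eq_pushforward_comp_inj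
    (hl : ∀ c, l c ≫ (bcFunctor k L).map a.nabla.incl = (e c ⊗ₘ e c) ≫ Functor.LaxMonoidal.μ (bcFunctor k L) X X)
    (hlα : ∀ c, l c ≫ (bcFunctor k L).map a.α = (𝒥 c).diff ≫ (ι c).hom.hom.hom)
    (hl' : ∀ c', l' c' ≫ (bcFunctor k L).map a'.nabla.incl = (e' c' ⊗ₘ e' c') ≫ Functor.LaxMonoidal.μ (bcFunctor k L) X' X')
    (hlα' : ∀ c', l' c' ≫ (bcFunctor k L).map a'.α = (𝒥' c').diff ≫ (ι' c').hom.hom.hom)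
    (ht : ∀ c, t c ≫ e' (φ c) = e c ≫ (bcFunctor k L).map f) (c : C) :
    ι c ≫ AbelianVariety.Hom.baseChange L (a.map a' f) = (𝒥 c).pushforward (𝒥' (φ c)) (t c) ≫ ι' (φ c) := by
  apply (𝒥 c).hom_ext
  change (𝒥 c).diff ≫ (ι c).hom.hom.hom ≫ (AbelianVariety.Hom.baseChange L (a.map a' f)).hom.hom.hom =
    (𝒥 c).diff ≫ ((𝒥 c).pushforward (𝒥' (φ c)) (t c)).hom.hom.hom ≫ (ι' (φ c)).hom.hom.hom
  rw [a.diff_comp_inj_comp_map_baseChange_eq L a' f E e 𝒥 ι l E' e' l' φ t hl hlα hl' ht c, hlα' (φ c),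
    (𝒥 c).diff_comp_pushforward_assoc]

/-- **The matrix form: `(Alb_f)_L = Σ_c π_c ≫ Nm_{t_c} ≫ ι'_{φ c}`** for projections `π_c` with `Σ_c π_c ≫ ι_c = 𝟙` (the biproduct
presentation `Alb_X ×_k L ≅ ∏_c J(E_c)` of ★ `Albanese.exists_isGalois_isLimit_fan_baseChange_compat`): the base change of the Albanese
map of `f` is the matrix of norm maps of the piece maps — «the Hecke correspondences act on `⊕ᵢ Alb_{Xᵢ}`» ([Liu2021] §4.2 l. 2074
read over the splitting field). [cite: Liu2021, §2.1 proof of the Proposition (FJcycle.tex l. 1194–1200), Def. 2.3 (l. 1206–1208) and §4.2 (l. 2074)]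
[cite: Lange2023AbelianVarietiesComplex, §4.5.2 (the norm map N_f)] -/
theorem map_baseChange_eq_sum_proj_pushforward_inj [Fintype C] (π : ∀ c, a.Alb.baseChange L ⟶ (𝒥 c).J)
    (htot : ∑ c, π c ≫ ι c = 𝟙 _)
    (hl : ∀ c, l c ≫ (bcFunctor k L).map a.nabla.incl = (e c ⊗ₘ e c) ≫ Functor.LaxMonoidal.μ (bcFunctor k L) X X)
    (hlα : ∀ c, l c ≫ (bcFunctor k L).map a.α = (𝒥 c).diff ≫ (ι c).hom.hom.hom)
    (hl' : ∀ c', l' c' ≫ (bcFunctor k L).map a'.nabla.incl = (e' c' ⊗ₘ e' c') ≫ Functor.LaxMonoidal.μ (bcFunctor k L) X' X')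
    (hlα' : ∀ c', l' c' ≫ (bcFunctor k L).map a'.α = (𝒥' c').diff ≫ (ι' c').hom.hom.hom)
    (ht : ∀ c, t c ≫ e' (φ c) = e c ≫ (bcFunctor k L).map f) :
    AbelianVariety.Hom.baseChange L (a.map a' f) = ∑ c, π c ≫ (𝒥 c).pushforward (𝒥' (φ c)) (t c) ≫ ι' (φ c) := by
  calc AbelianVariety.Hom.baseChange L (a.map a' f)
      = (∑ c, π c ≫ ι c) ≫ AbelianVariety.Hom.baseChange L (a.map a' f) := by rw [htot, Category.id_comp]
    _ = ∑ c, π c ≫ (𝒥 c).pushforward (𝒥' (φ c)) (t c) ≫ ι' (φ c) := by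
        rw [Preadditive.sum_comp]
        exact Finset.sum_congr rfl fun c _ => by
          rw [Category.assoc, a.inj_comp_map_baseChange_eq_pushforward_comp_inj L a' f E e 𝒥 ι l E' e' 𝒥' ι' l' φ t hl hlα hl' hlα' ht c]

/-- **A homomorphism INTO the Albanese, read on pieces**: dually, for `π'` projections of the target presentation with
`Σ π' ≫ ι' = 𝟙` and the orthogonality `ι'_{c'} ≫ π'_{c''} = 0` (`c' ≠ c''`), `ι'_{c'} ≫ π'_{c'} = 𝟙`, the `(c, c')`-entry of `(Alb_f)_L` is
`ι_c ≫ (Alb_f)_L ≫ π'_{c'} = Nm_{t_c}` if `c' = φ c` and `0` otherwise — stated as the two composites. [cite: Liu2021, §2.1 proof of the Proposition (FJcycle.tex l. 1194–1200) and §4.2 (l. 2074)]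
[cite: Lange2023AbelianVarietiesComplex, §4.5.2 (the norm map N_f)] -/
theorem inj_comp_map_baseChange_comp_proj (π' : ∀ c', a'.Alb.baseChange L ⟶ (𝒥' c').J)
    (hιπ' : ∀ c', ι' c' ≫ π' c' = 𝟙 _) (hιπ'_ne : ∀ c' c'', c' ≠ c'' → ι' c' ≫ π' c'' = 0)
    (hl : ∀ c, l c ≫ (bcFunctor k L).map a.nabla.incl = (e c ⊗ₘ e c) ≫ Functor.LaxMonoidal.μ (bcFunctor k L) X X)
    (hlα : ∀ c, l c ≫ (bcFunctor k L).map a.α = (𝒥 c).diff ≫ (ι c).hom.hom.hom)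
    (hl' : ∀ c', l' c' ≫ (bcFunctor k L).map a'.nabla.incl = (e' c' ⊗ₘ e' c') ≫ Functor.LaxMonoidal.μ (bcFunctor k L) X' X')
    (hlα' : ∀ c', l' c' ≫ (bcFunctor k L).map a'.α = (𝒥' c').diff ≫ (ι' c').hom.hom.hom)
    (ht : ∀ c, t c ≫ e' (φ c) = e c ≫ (bcFunctor k L).map f) (c : C) (c' : C') :
    (φ c = c' → ι c ≫ AbelianVariety.Hom.baseChange L (a.map a' f) ≫ π' (φ c) = (𝒥 c).pushforward (𝒥' (φ c)) (t c)) ∧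
      (φ c ≠ c' → ι c ≫ AbelianVariety.Hom.baseChange L (a.map a' f) ≫ π' c' = 0) := by
  refine ⟨fun _ => ?_, fun hne => ?_⟩
  · rw [← Category.assoc, a.inj_comp_map_baseChange_eq_pushforward_comp_inj L a' f E e 𝒥 ι l E' e' 𝒥' ι' l' φ t hl hlα hl' hlα' ht c,
      Category.assoc, hιπ', Category.comp_id]
  · rw [← Category.assoc, a.inj_comp_map_baseChange_eq_pushforward_comp_inj L a' f E e 𝒥 ι l E' e' 𝒥' ι' l' φ t hl hlα hl' hlα' ht c,
      Category.assoc, hιπ'_ne (φ c) c' hne, Limits.comp_zero]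

end Albanese

end Literature.NumberTheory.Automorphic.Liu2021.AppendixC

end
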